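import Summits.ValiantsHypothesis.ValiantsHypothesis.Theorems.GrenetZeonDualUnipotentThreeHalvesHeavyTopHalfSpeedSeam

/-!
# `GrenetZeon.DualUnipotentThreeHalves` (stmt-ValiantsHypothesis-24318), LINE β `half_speed`, stub K1 — the REINDEX BRIDGE:
# a two-level block-upper set of `d × d` matrices (levels given by a predicate on `Fin d`) glues its half-speed profiles

K1's chain loop works on `Fin d` with a level predicate (✓ `HeavyTopCompositionBound.exists_block_conj` produces level functions),
while the gluing lemma lives on `ι₁ ⊕ ι₂`.  `halfSpeed_of_two_levels` bridges the two: for a predicate `p` on the index type, if every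
member of `U` (resp. `T`) has zero entries from the `¬p`-rows into the `p`-columns and diagonal blocks (`Matrix.toBlock`) in
`U₁, U₂` (resp. `T₁, T₂`), then `HalfSpeed Θ₁ U₁ T₁ → HalfSpeed Θ₂ U₂ T₂ → HalfSpeed (Θ₁ + Θ₂ + 1) U T` — via the reindexing
`Equiv.sumCompl p` (✓ `halfSpeed_reindex`) and ✓ `halfSpeed_of_blocks`.
Honest framing: plumbing for a stub of LINE β; nothing here proves `HalfSpeedLaw`, `HalfSpeedIrrLaw`, `HeavyTopLaw`, 24318, S3b or
8062; `VP ≠ VNP` is not moved; no summit statement is proved here.  No definitions, no named facts. [β card K1; val-port-3 g2]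
-/

noncomputable section

-- single-conjunct layout: Sub = Summit, duplicated namespace component intended
set_option linter.dupNamespace false

namespace Summit.ValiantsHypothesis.ValiantsHypothesis.Theorems.GrenetZeon.HalfSpeed

open Matrix

variable {ι : Type*} [Fintype ι] [DecidableEq ι] (p : ι → Prop) [DecidablePred p]

omit [Fintype ι] [DecidableEq ι] in
/-- After reindexing by `(Equiv.sumCompl p).symm : ι ≃ {i // p i} ⊕ {i // ¬ p i}`, the `(2,1)` block of `A` is the block of
entries from `¬p`-rows into `p`-columns, and the diagonal blocks are `A.toBlock p p`, `A.toBlock ¬p ¬p`. -/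
theorem toBlocks_reindex_sumCompl (A : Matrix ι ι ℂ) :
    (Matrix.reindex (Equiv.sumCompl p).symm (Equiv.sumCompl p).symm A).toBlocks₁₁ = A.toBlock p p ∧
    (Matrix.reindex (Equiv.sumCompl p).symm (Equiv.sumCompl p).symm A).toBlocks₂₂ =
      A.toBlock (fun i => ¬ p i) (fun i => ¬ p i) ∧
    ((Matrix.reindex (Equiv.sumCompl p).symm (Equiv.sumCompl p).symm A).toBlocks₂₁ = 0 ↔
      ∀ i j, ¬ p i → p j → A i j = 0) := by
  refine ⟨?_, ?_, ?_⟩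
  · ext i j; simp [Matrix.toBlocks₁₁, Matrix.toBlock]
  · ext i j; simp [Matrix.toBlocks₂₂, Matrix.toBlock]
  · constructor
    · intro h i j hi hj
      have := congrFun (congrFun h ⟨i, hi⟩) ⟨j, hj⟩
      simpa [Matrix.toBlocks₂₁] using this
    · intro h
      ext i j
      simpa [Matrix.toBlocks₂₁] using h i j i.2 j.2

/-- **REINDEX BRIDGE (two levels).**  A two-level block-upper set of matrices over `ι` (levels by a predicate `p`: entries from
`¬p`-rows into `p`-columns vanish) whose diagonal blocks are certified glues its profiles: `HalfSpeed (Θ₁ + Θ₂ + 1) U T`.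
[β card K1; ✓ `halfSpeed_of_blocks`, ✓ `halfSpeed_reindex`] -/
theorem halfSpeed_of_two_levels (Θ₁ Θ₂ : ℕ) (U T : Set (Matrix ι ι ℂ))
    (U₁ T₁ : Set (Matrix {i // p i} {i // p i} ℂ)) (U₂ T₂ : Set (Matrix {i // ¬ p i} {i // ¬ p i} ℂ))
    (hU : ∀ A ∈ U, (∀ i j, ¬ p i → p j → A i j = 0) ∧ A.toBlock p p ∈ U₁ ∧
      A.toBlock (fun i => ¬ p i) (fun i => ¬ p i) ∈ U₂)
    (hT : ∀ A ∈ T, (∀ i j, ¬ p i → p j → A i j = 0) ∧ A.toBlock p p ∈ T₁ ∧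
      A.toBlock (fun i => ¬ p i) (fun i => ¬ p i) ∈ T₂)
    (h₁ : HalfSpeed Θ₁ U₁ T₁) (h₂ : HalfSpeed Θ₂ U₂ T₂) : HalfSpeed (Θ₁ + Θ₂ + 1) U T := by
  set e := (Equiv.sumCompl p).symm with he
  -- the reindexed sets are block-upper with the prescribed diagonal blocks
  have hglued : HalfSpeed (Θ₁ + Θ₂ + 1) ((Matrix.reindex e e) '' U) ((Matrix.reindex e e) '' T) := by
    refine halfSpeed_of_blocks Θ₁ Θ₂ _ _ U₁ T₁ U₂ T₂ ?_ ?_ h₁ h₂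
    · rintro _ ⟨A, hA, rfl⟩
      obtain ⟨hz, h11, h22⟩ := hU A hA
      obtain ⟨e11, e22, e21⟩ := toBlocks_reindex_sumCompl p A
      exact ⟨e21.2 hz, e11 ▸ h11, e22 ▸ h22⟩
    · rintro _ ⟨A, hA, rfl⟩
      obtain ⟨hz, h11, h22⟩ := hT A hA
      obtain ⟨e11, e22, e21⟩ := toBlocks_reindex_sumCompl p A
      exact ⟨e21.2 hz, e11 ▸ h11, e22 ▸ h22⟩
  -- transport back along `e.symm`
  have hback := halfSpeed_reindex e.symm (Θ₁ + Θ₂ + 1) _ _ hglued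
  have hUU : (Matrix.reindex e.symm e.symm) '' ((Matrix.reindex e e) '' U) = U := by
    rw [Set.image_image]; convert Set.image_id U; ext A i; simp
  have hTT : (Matrix.reindex e.symm e.symm) '' ((Matrix.reindex e e) '' T) = T := by
    rw [Set.image_image]; convert Set.image_id T; ext A i; simp
  rwa [hUU, hTT] at hback

end Summit.ValiantsHypothesis.ValiantsHypothesis.Theorems.GrenetZeon.HalfSpeed

end
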